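import Summits.Ventures.Crystal3D.Theorems.StickyWulffConstantStackingLiminfModulatedWulff
import HarnessLib

/-!
# Rung R5 of line `LayerChain` v4 (crux `StackingLiminf`, stmt-Ventures-19145): the constant-profile
# case of the modulated Wulff inequality

Route `StickyWulffConstant` of the venture `Summits/Ventures/Crystal3D` (cell `crystal3d-full`).
`rung_modulatedWulff_const` is the planner's rung R5 (`HOME/cf-p1/route/lines/LayerChainV4Rungs.lean`,
evidence #23 on stmt-Ventures-19145) VERBATIM: for every `C²` compactly supported `w ≥ 0` on `ℝ³` and
every constant letter density `f ∈ [0,1]`,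
`3 (64√2)^{1/3} · plateau w ≤ modTV w (fun _ => f)` — the sharp anisotropic Wulff inequality for smooth
functions with the gauge `stackTension f` (Wulff body `W_f`, `|W_f| ≥ |W_0| = 64√2`), i.e. the
Brunn–Minkowski/Gromov form of the Wulff inequality, no BV.  It is the specialisation `g ≡ f` of the
landed stub (A) `stub_modulatedWulff` (p506908).
WHAT THIS IS NOT: nothing discrete; rung F-C1 not moved.
-/

noncomputable section

namespace Summit.Ventures.Crystal3D.Theorems

open Summit.Ventures.Crystal3D.Cruxes.StackingLiminf.LayerChainV4 (modTV plateau)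

/-- **Rung R5 (constant profile).**  For `C²` compactly supported `w ≥ 0` and `f ∈ [0,1]`:
`3 (64√2)^{1/3} · ∫_0^∞ |{w>t}|^{2/3} dt ≤ ∫ φ_f(−∇w(y)) dy`. -/
theorem rung_modulatedWulff_const (w : (Fin 3 → ℝ) → ℝ) (f : ℝ) (hw : ContDiff ℝ 2 w)
    (hws : HasCompactSupport w) (hw0 : ∀ y, 0 ≤ w y) (hf0 : 0 ≤ f) (hf1 : f ≤ 1) :
    3 * (64 * Real.sqrt 2) ^ ((1 : ℝ) / 3) * plateau w ≤ modTV w (fun _ => f) :=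
  stub_modulatedWulff w (fun _ => f) hw hws hw0 continuous_const fun _ => ⟨hf0, hf1⟩

end Summit.Ventures.Crystal3D.Theorems

end
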